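import Summits.QuantumFields.YangMills.Theorems.BalabanUVNodesN22KnitBindersInhabited

/-!
# A6 WITNESSES FOR THIS LINEAGE's N18 → N22 KNITS, PART 2 — the abstract slots (A) ∕ (A′) ∕ (R₂), the «`FadingMemory` by name» face, and two CoPH stub-level knits' OWN
# binder lists with `S_N18 (RRec₁₃CoPH …)` as a conjunct (STANDING A6 RULE, director-ym LINE №189 (3); LINE №193 (4) «… on n22-e's home files»)

Continuation of `BalabanUVNodesN22KnitBindersInhabited` (Part 1: the device, the letters, `N18At` at vanishing functionals, the three θ-form EDGE lemmas) — same DEGENERATE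
witness (W1's termless generators, the admissible reading of record on their run towers, Part 1's letters), same framing.  §1 proves the slot binder lists at ANY W1 reading datum `D`
whose level functionals vanish (`…_binders_of_EA_zero`, so the stub-level `hslot` ∕ `hO`+`hA` ∕ `h9` binders of every edition are these lists at `D := w1 F θ`, pointwise —
`readingOfRecord₁₃CoPH_u3` is `rfl`); §2 exhibits such a `D` at every Stage-13 tuple (`exists_readingData_EA_zero`) and states the θ-form witnesses; §3 states, for the two
CoPH knits whose first hypothesis is `S_N18` AT THE v1.7 RATE RECORD, the FULL binder list in №189 (3)'s literal shape — `S_N18 (RRec₁₃CoPH (readingOfRecord₁₃CoPH …))`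
is obtained from `N18At` at vanishing functionals at EVERY datum key of record (6″'s `s_N18_readingOfRecord₁₃CoPH_iff`), NOT from emptiness of the key class.

A6 INDEX, PART 2 (stub-level theorems ↦ θ-form lemma ↦ witness; «ed.» = the same-named twin in each Record-13 edition `…13 ∕ 13Sep ∕ 13Co ∕ 13CoP ∕ 13CoPR ∕ 13CoPH`):
* 9″a `…N22AtRateRecord13CoPH` `s_N22_rRec₁₃CoPH_of_oscAnalytic` · 9″c `s_N22_rRec₁₃CoPH_w1_of_oscAnalytic` · 6″ `s_N22_readingOfRecord₁₃CoPH_of_oscAnalytic`, ed.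
  ↦ 9‴a §2 `n22At_u3OfRecord₁₃_of_oscAnalytic` ↦ §1 `oscAnalytic_binders_of_EA_zero` ∕ §2 `oscAnalytic_binders_inhabited`.
* 9″a `s_N22_rRec₁₃CoPH_of_oscStrip`, ed. ↦ `n22At_u3OfRecord₁₃_of_oscStrip` ↦ §1 `oscStrip_binders_of_EA_zero` ∕ §2 `oscStrip_binders_inhabited`.
* 9″a `s_N22_rRec₁₃CoPH_of_oscSecondDiff`, ed. ↦ `n22At_u3OfRecord₁₃_of_oscSecondDiff` ↦ §1 `oscSecondDiff_binders_of_EA_zero` ∕ §2 `oscSecondDiff_binders_inhabited`.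
* 9″b `s_N22_rRec₁₃CoPH_of_ne9_fading` ∕ `_of_w1` · 9″c `s_N22_rRec₁₃CoPH_w1_of_ne9_fading` ∕ `_w1_iff_ne9` · 6″ `s_N22_readingOfRecord₁₃CoPH_of_ne9_fading` ∕ `_iff_ne9`, ed.
  ↦ 9‴b `n22At_u3OfRecord₁₃_of_ne9_fading` ∕ `_of_ne9_le` ↦ §1 `ne9_fading_binders_of_EA_zero` ∕ §2 `ne9_fading_binders_inhabited`.
* 9″a `s_N22_rRec₁₃CoPH_of_s_N18(_strip ∕ _analytic)` (slot roads from `S_N18` at the tower-keyed record), ed. ↦ this seat's g0 `…N22AtRecordTowerKeyed` — in-file there: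
  `s_N18_toyTowerRecord` ∕ `s_N22_toyTowerRecord`.
* 8c″ `s_N22_readingOfRecord₁₃CoPH_gen_of_s_N18_schemasBelow` (+ its 7 siblings, pointwise) ↦ §3 `…_binders_inhabited` (G, sp, gauge, T₀, li, ℓ₃, ne2 exhibited; `S_N18` ∧ hsch ∧ hnum).
* 8a″ `s_N22_readingOfRecord₁₃CoPH_ofRecordAdm_of_s_N18_analytic` (+ `…On…` ∕ strip siblings; 7″'s six via dag-n22-c's `pairingCoherence_ofRecordAdm`) ↦ §3 `…_binders_inhabited`.
The dressed-tower coordinate `ne1 : … → NE1pCarriers` of a rate reading is PASSIVE for every N18 ∕ N22 binder and is universally quantified in §3 (its own inhabitation is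
N14's ∕ K0's matter: `Record11Inhabited`, dag-n14's `…N14RecordCensus`).

HONEST FRAMING.  As Part 1: A6 bookkeeping with a DEGENERATE inhabitant — INHABITATION IS NOT CONTENT (termless towers: the knits are not vacuous, and not thereby substantive; nothing of Bałaban's asserted or instantiated; NE5 ∕ NE9 NOT PRINTED for d = 4 and
NOT PROVED; no inhabitant of `IsDatumOfRecord₁₃CCoPH` claimed — K0 OPEN; N22 NOT discharged; counts UNMOVED (typed 28∕28 · discharged 5∕27); finite 𝕋⁴ at fixed `ε` — NOT ℝ⁴,
NOT OS, NOT a mass gap, NOT Clay).  Filed `--kind proof --supports stmt-QuantumFields-20544 --as helper` (K3⁷, WORDS-143); COUNT-NEUTRAL.  0 `def`, 0 `sorry`; no decl carries a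
cite tag ([folklore]).  Seat `pub-ymgap-dag-n22-e` gen 15.
-/

noncomputable section

namespace YMDAG.N22

open Set Metric ComplexConjugate
open scoped BigOperators
open Literature.MathematicalPhysics.QuantumFieldTheory.Balaban1983to89
open Literature.MathematicalPhysics.QuantumFieldTheory.Balaban1983to89.T4Continuum
open Literature.MathematicalPhysics.QuantumFieldTheory.Balaban1983to89.T4OutputRate
open Literature.MathematicalPhysics.QuantumFieldTheory.Balaban1983to89.Node00
  (Stage13Params Stage13HParams NE2Objects₁₁ NE3Letters₁₁ MatA ιSU)
open Literature.MathematicalPhysics.QuantumFieldTheory.Balaban1983to89.Node00.Sect2 (domSys CPair ofBackgroundC)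
open Literature.MathematicalPhysics.QuantumFieldTheory.Balaban1983to89.Node00.W1
open YMDAG.UVSplit

variable {N : ℕ} [NeZero N]

/-! ## §1 The three abstract slots of 9‴a §2 and 9‴b's `FadingMemory`-by-name face hold at ANY W1 reading with VANISHING level functionals -/

section SlotsCore

variable {F : T4Family} (θ : Stage13Params F N) (D : ReadingData F (MatA N) θ.τ9.M)

/-- **THE ANALYTIC SLOT (A) OF 9‴a §2 IS INHABITED AT ANY W1 READING WHOSE LEVEL FUNCTIONALS VANISH** (`n22At_u3OfRecord₁₃_of_oscAnalytic` at `u := D.u3Objects θ.γ`; hence 9″a's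
`s_N22_rRec₁₃…_of_oscAnalytic`, 9″c's `…_w1_of_oscAnalytic`, 6″'s `…readingOfRecord₁₃…_of_oscAnalytic` in every Record-13 edition, whose `hslot` ∕ `hO`+`hA` binders are this
list per tuple): given the eleven numerals of `D.li` and `0 < θ.γ`, at every run length there are slot constants `C₀ M μ r s` with (P), (O), (A) (extension `0` on `univ`),
the nine signs and BOTH letter equations (`rfl` for the reading's analytic block).  INHABITATION IS NOT CONTENT. [folklore] -/
theorem oscAnalytic_binders_of_EA_zero (hEA : ∀ (k : ℕ) (g : ℕ → ℝ) U X, (D.u3Objects θ.γ).EA k g U X = 0)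
    (hnum : 0 < D.li.C₀ ∧ 0 < D.li.θ₅ ∧ D.li.θ₅ < 1 ∧ 0 ≤ D.li.C₅ ∧ 2 * D.li.C₅ / (1 - D.li.θ₅) ≤ D.li.C₀ ∧ 0 < D.li.A ∧ D.li.θ₅ ≤ D.li.μ ∧
      D.li.C₀ ≤ 2 * D.li.A ∧ 0 < D.li.r ∧ 0 < D.li.s ∧ D.li.s < 1) (hγ : 0 < θ.γ) (k : ℕ) :
    ∃ C₀ M μ r s : ℝ,
      PrefixDependenceOn ((D.u3Objects θ.γ).EA k) (Window θ.γ) ∧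
      (∀ g ∈ Window θ.γ, ∀ g' ∈ Window θ.γ, ∀ (U : ((D.u3Objects θ.γ).levelCarriers k).BgA) (X : ((D.u3Objects θ.γ).levelCarriers k).Dom) (a : ℕ),
        a ≤ ((D.u3Objects θ.γ).levelCarriers k).scale X → (∀ n, a ≤ n → g n = g' n) →
          |(D.u3Objects θ.γ).EA k g U X - (D.u3Objects θ.γ).EA k g' U X| ≤
            C₀ * (D.u3Objects θ.γ).θ₅ ^ (((D.u3Objects θ.γ).levelCarriers k).scale X - a) * Real.exp (-((D.u3Objects θ.γ).κ * ((D.u3Objects θ.γ).levelCarriers k).d X))) ∧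
      (∀ g ∈ Window θ.γ, ∀ (U : ((D.u3Objects θ.γ).levelCarriers k).BgA) (X : ((D.u3Objects θ.γ).levelCarriers k).Dom) (i : ℕ),
        i < ((D.u3Objects θ.γ).levelCarriers k).scale X → ∃ (Fz : ℂ → ℂ) (Dset : Set ℂ), DifferentiableOn ℂ Fz Dset ∧
          (∀ z ∈ Dset, ‖Fz z‖ ≤ M * μ ^ (((D.u3Objects θ.γ).levelCarriers k).scale X - 1 - i) * Real.exp (-((D.u3Objects θ.γ).κ * ((D.u3Objects θ.γ).levelCarriers k).d X))) ∧
          (∀ t ∈ Ioc (0 : ℝ) θ.γ, closedBall (t : ℂ) r ⊆ Dset) ∧ (∀ t ∈ Ioc (0 : ℝ) θ.γ, Fz t = ((D.u3Objects θ.γ).EA k (Function.update g i t) U X : ℂ))) ∧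
      0 < C₀ ∧ 0 < (D.u3Objects θ.γ).θ₅ ∧ 0 < M ∧ (D.u3Objects θ.γ).θ₅ ≤ μ ∧ C₀ ≤ 2 * M ∧ 0 < r ∧ 0 < θ.γ ∧ 0 < s ∧ s < 1 ∧
      (D.u3Objects θ.γ).ω = (D.u3Objects θ.γ).θ₅ ^ (1 - s) * μ ^ s ∧
      (D.u3Objects θ.γ).C₉ = 32 / (s ^ 2 * min (r / 2) (θ.γ / 2)) * (C₀ ^ (1 - s) * (2 * M) ^ s) / ((D.u3Objects θ.γ).θ₅ ^ (1 - s) * μ ^ s) := by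
  refine ⟨D.li.C₀, D.li.A, D.li.μ, D.li.r, D.li.s, D.prefixDependenceOn_u3Objects_EA θ.γ k (Window θ.γ), ?_, ?_, hnum.1, hnum.2.1, hnum.2.2.2.2.2.1,
    hnum.2.2.2.2.2.2.1, hnum.2.2.2.2.2.2.2.1, hnum.2.2.2.2.2.2.2.2.1, hγ, hnum.2.2.2.2.2.2.2.2.2.1, hnum.2.2.2.2.2.2.2.2.2.2, rfl, rfl⟩
  · intro g _ g' _ U X a _ _
    rw [hEA, hEA, sub_zero, abs_zero]
    exact mul_nonneg (mul_nonneg hnum.1.le (pow_nonneg hnum.2.1.le _)) (Real.exp_nonneg _)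
  · intro g _ U X i _
    refine ⟨fun _ => 0, univ, differentiableOn_const 0, fun z _ => ?_, fun t _ => subset_univ _, fun t _ => ?_⟩
    · rw [norm_zero]
      exact mul_nonneg (mul_nonneg hnum.2.2.2.2.2.1.le (pow_nonneg (hnum.2.1.le.trans hnum.2.2.2.2.2.2.1) _)) (Real.exp_nonneg _)
    · rw [hEA]
      simp

/-- **THE STRIP SLOT (A′) OF 9‴a §2 IS INHABITED AT ANY W1 READING WITH VANISHING LEVEL FUNCTIONALS** (`n22At_u3OfRecord₁₃_of_oscStrip`; hence 9″a's `…_of_oscStrip`): (P), (O),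
(A′) with the DERIVATIVE letter (`deriv 0 = 0`), the signs with `L := A ∕ r` (so `2(L·r) = 2A` meets the block's `C₉` equation), the letter equations. [folklore] -/
theorem oscStrip_binders_of_EA_zero (hEA : ∀ (k : ℕ) (g : ℕ → ℝ) U X, (D.u3Objects θ.γ).EA k g U X = 0)
    (hnum : 0 < D.li.C₀ ∧ 0 < D.li.θ₅ ∧ D.li.θ₅ < 1 ∧ 0 ≤ D.li.C₅ ∧ 2 * D.li.C₅ / (1 - D.li.θ₅) ≤ D.li.C₀ ∧ 0 < D.li.A ∧ D.li.θ₅ ≤ D.li.μ ∧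
      D.li.C₀ ≤ 2 * D.li.A ∧ 0 < D.li.r ∧ 0 < D.li.s ∧ D.li.s < 1) (hγ : 0 < θ.γ) (k : ℕ) :
    ∃ C₀ L μ r s : ℝ,
      PrefixDependenceOn ((D.u3Objects θ.γ).EA k) (Window θ.γ) ∧
      (∀ g ∈ Window θ.γ, ∀ g' ∈ Window θ.γ, ∀ (U : ((D.u3Objects θ.γ).levelCarriers k).BgA) (X : ((D.u3Objects θ.γ).levelCarriers k).Dom) (a : ℕ),
        a ≤ ((D.u3Objects θ.γ).levelCarriers k).scale X → (∀ n, a ≤ n → g n = g' n) →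
          |(D.u3Objects θ.γ).EA k g U X - (D.u3Objects θ.γ).EA k g' U X| ≤
            C₀ * (D.u3Objects θ.γ).θ₅ ^ (((D.u3Objects θ.γ).levelCarriers k).scale X - a) * Real.exp (-((D.u3Objects θ.γ).κ * ((D.u3Objects θ.γ).levelCarriers k).d X))) ∧
      (∀ g ∈ Window θ.γ, ∀ (U : ((D.u3Objects θ.γ).levelCarriers k).BgA) (X : ((D.u3Objects θ.γ).levelCarriers k).Dom) (i : ℕ),
        i < ((D.u3Objects θ.γ).levelCarriers k).scale X → ∃ (Fz : ℂ → ℂ) (Dset : Set ℂ), DifferentiableOn ℂ Fz Dset ∧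
          (∀ z ∈ Dset, ‖deriv Fz z‖ ≤ L * μ ^ (((D.u3Objects θ.γ).levelCarriers k).scale X - 1 - i) * Real.exp (-((D.u3Objects θ.γ).κ * ((D.u3Objects θ.γ).levelCarriers k).d X))) ∧
          (∀ t ∈ Ioc (0 : ℝ) θ.γ, ball (t : ℂ) r ⊆ Dset) ∧ (∀ t ∈ Ioc (0 : ℝ) θ.γ, Fz t = ((D.u3Objects θ.γ).EA k (Function.update g i t) U X : ℂ))) ∧
      0 < C₀ ∧ 0 < (D.u3Objects θ.γ).θ₅ ∧ 0 < L ∧ (D.u3Objects θ.γ).θ₅ ≤ μ ∧ C₀ ≤ 2 * (L * r) ∧ 0 < r ∧ 0 < θ.γ ∧ 0 < s ∧ s < 1 ∧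
      (D.u3Objects θ.γ).ω = (D.u3Objects θ.γ).θ₅ ^ (1 - s) * μ ^ s ∧
      (D.u3Objects θ.γ).C₉ = 32 / (s ^ 2 * min (r / 2) (θ.γ / 2)) * (C₀ ^ (1 - s) * (2 * (L * r)) ^ s) / ((D.u3Objects θ.γ).θ₅ ^ (1 - s) * μ ^ s) := by
  have hr : 0 < D.li.r := hnum.2.2.2.2.2.2.2.2.1
  have hLr : D.li.A / D.li.r * D.li.r = D.li.A := div_mul_cancel₀ D.li.A hr.ne'
  refine ⟨D.li.C₀, D.li.A / D.li.r, D.li.μ, D.li.r, D.li.s, D.prefixDependenceOn_u3Objects_EA θ.γ k (Window θ.γ), ?_, ?_, hnum.1, hnum.2.1, div_pos hnum.2.2.2.2.2.1 hr,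
    hnum.2.2.2.2.2.2.1, by rw [hLr]; exact hnum.2.2.2.2.2.2.2.1, hr, hγ, hnum.2.2.2.2.2.2.2.2.2.1, hnum.2.2.2.2.2.2.2.2.2.2, rfl, by rw [hLr]; rfl⟩
  · intro g _ g' _ U X a _ _
    rw [hEA, hEA, sub_zero, abs_zero]
    exact mul_nonneg (mul_nonneg hnum.1.le (pow_nonneg hnum.2.1.le _)) (Real.exp_nonneg _)
  · intro g _ U X i _
    refine ⟨fun _ => 0, univ, differentiableOn_const 0, fun z _ => ?_, fun t _ => subset_univ _, fun t _ => ?_⟩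
    · rw [deriv_const, norm_zero]
      exact mul_nonneg (mul_nonneg (div_pos hnum.2.2.2.2.2.1 hr).le (pow_nonneg (hnum.2.1.le.trans hnum.2.2.2.2.2.2.1) _)) (Real.exp_nonneg _)
    · rw [hEA]
      simp

/-- **THE SECOND-DIFFERENCE SLOT (R₂) OF 9‴a §2 IS INHABITED AT ANY W1 READING WITH VANISHING LEVEL FUNCTIONALS** (`n22At_u3OfRecord₁₃_of_oscSecondDiff`; hence 9″a's
`…_of_oscSecondDiff`): given the block's signs and rate pin at radius `θ.γ` — (P), (O) with `C₀ := θ.γ·C₉·ω∕4 ≥ 0`, second differences with `M := 0`, the signs with the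
slot's `μ := 0`, `ρ := 1`, and the letter equation `C₉ = (4C₀∕θ.γ + M·θ.γ∕2)∕ω` (by the choice of `C₀`). [folklore] -/
theorem oscSecondDiff_binders_of_EA_zero (hEA : ∀ (k : ℕ) (g : ℕ → ℝ) U X, (D.u3Objects θ.γ).EA k g U X = 0) (hsg : (D.li.analytic θ.γ).Signs)
    (hθω : D.li.θ₅ ≤ (D.li.analytic θ.γ).ω) (hω0 : 0 < (D.li.analytic θ.γ).ω) (hγ : 0 < θ.γ) (k : ℕ) :
    ∃ C₀ M μ ρ : ℝ,
      PrefixDependenceOn ((D.u3Objects θ.γ).EA k) (Window θ.γ) ∧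
      (∀ g ∈ Window θ.γ, ∀ g' ∈ Window θ.γ, ∀ (U : ((D.u3Objects θ.γ).levelCarriers k).BgA) (X : ((D.u3Objects θ.γ).levelCarriers k).Dom) (a : ℕ),
        a ≤ ((D.u3Objects θ.γ).levelCarriers k).scale X → (∀ n, a ≤ n → g n = g' n) →
          |(D.u3Objects θ.γ).EA k g U X - (D.u3Objects θ.γ).EA k g' U X| ≤
            C₀ * (D.u3Objects θ.γ).θ₅ ^ (((D.u3Objects θ.γ).levelCarriers k).scale X - a) * Real.exp (-((D.u3Objects θ.γ).κ * ((D.u3Objects θ.γ).levelCarriers k).d X))) ∧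
      (∀ g ∈ Window θ.γ, ∀ (U : ((D.u3Objects θ.γ).levelCarriers k).BgA) (X : ((D.u3Objects θ.γ).levelCarriers k).Dom) (i : ℕ),
        i < ((D.u3Objects θ.γ).levelCarriers k).scale X → ∀ t d : ℝ, 0 < d → t - d ∈ Ioc (0 : ℝ) θ.γ → t + d ∈ Ioc (0 : ℝ) θ.γ →
          |(D.u3Objects θ.γ).EA k (Function.update g i (t + d)) U X - 2 * (D.u3Objects θ.γ).EA k (Function.update g i t) U X +
              (D.u3Objects θ.γ).EA k (Function.update g i (t - d)) U X| ≤
            M * μ ^ (((D.u3Objects θ.γ).levelCarriers k).scale X - 1 - i) * Real.exp (-((D.u3Objects θ.γ).κ * ((D.u3Objects θ.γ).levelCarriers k).d X)) * d ^ 2) ∧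
      0 ≤ C₀ ∧ 0 ≤ (D.u3Objects θ.γ).θ₅ ∧ 0 ≤ M ∧ 0 ≤ μ ∧ 0 < θ.γ ∧ 0 < ρ ∧ ρ ≤ 1 ∧
      (D.u3Objects θ.γ).θ₅ ≤ (D.u3Objects θ.γ).ω * ρ ∧ μ * ρ ≤ (D.u3Objects θ.γ).ω ∧ 0 < (D.u3Objects θ.γ).ω ∧
      (D.u3Objects θ.γ).C₉ = (4 * C₀ / θ.γ + M * θ.γ / 2) / (D.u3Objects θ.γ).ω := by
  have hC₉ : 0 ≤ (D.li.analytic θ.γ).C₉ := hsg.C₉_nonneg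
  refine ⟨θ.γ * (D.li.analytic θ.γ).C₉ * (D.li.analytic θ.γ).ω / 4, 0, 0, 1, D.prefixDependenceOn_u3Objects_EA θ.γ k (Window θ.γ), ?_, ?_, by positivity,
    hsg.θ₅_pos.le, le_rfl, le_rfl, hγ, one_pos, le_rfl, ?_, ?_, hω0, ?_⟩
  · intro g _ g' _ U X a _ _
    rw [hEA, hEA, sub_zero, abs_zero]
    exact mul_nonneg (mul_nonneg (by positivity) (pow_nonneg hsg.θ₅_pos.le _)) (Real.exp_nonneg _)
  · intro g _ U X i _ t d _ _ _
    rw [hEA, hEA, hEA]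
    simp
  · show D.li.θ₅ ≤ (D.li.analytic θ.γ).ω * 1
    rw [mul_one]; exact hθω
  · show (0 : ℝ) * 1 ≤ (D.li.analytic θ.γ).ω
    rw [zero_mul]; exact hω0.le
  · show (D.li.analytic θ.γ).C₉ = (4 * (θ.γ * (D.li.analytic θ.γ).C₉ * (D.li.analytic θ.γ).ω / 4) / θ.γ + 0 * θ.γ / 2) / (D.li.analytic θ.γ).ω
    field_simp
    ring

/-- **9‴b's «`FadingMemory` BY NAME FROM A MODULUS» IS INHABITED AT ANY W1 READING WITH VANISHING LEVEL FUNCTIONALS** (`n22At_u3OfRecord₁₃_of_ne9_fading` ∕ `_of_ne9_le`;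
hence 9″b's `…_of_ne9_fading`, 9″c's `…_w1_of_ne9_fading` ∕ `…_w1_iff_ne9`, 6″'s `…readingOfRecord₁₃…_of_ne9_fading`): the displayed SIGNS and, at every run length, NE9 of the
level functional in a FADING table — `Λ := 0`, `C₉ := 0`, `ω := u.ω`. [folklore] -/
theorem ne9_fading_binders_of_EA_zero (hEA : ∀ (k : ℕ) (g : ℕ → ℝ) U X, (D.u3Objects θ.γ).EA k g U X = 0) (hsg : (D.li.analytic θ.γ).Signs) :
    (D.u3Objects θ.γ).Signs ∧ ∀ k : ℕ, ∃ (Λ : ℕ → ℕ → ℝ) (C₉ ω : ℝ),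
      NE9 ((D.u3Objects θ.γ).EA k) (Window θ.γ) (D.u3Objects θ.γ).κ Λ ∧ FadingMemory C₉ ω Λ ∧ C₉ ≤ (D.u3Objects θ.γ).C₉ ∧ ω = (D.u3Objects θ.γ).ω := by
  refine ⟨hsg, fun k => ⟨fun _ _ => 0, 0, _, ?_, fun _ _ _ => ⟨le_rfl, by simp⟩, hsg.C₉_nonneg, rfl⟩⟩
  intro g _ g' _ U X
  rw [hEA, hEA, sub_zero, abs_zero]
  simp

end SlotsCore

/-! ## §2 … and such a reading EXISTS at every Stage-13 tuple: the θ-level slot binders are inhabited -/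

section Slots

variable {F : T4Family} (θ : Stage13Params F N)

omit [NeZero N] in
/-- **A W1 READING DATUM WITH VANISHING LEVEL FUNCTIONALS AND ALL LETTER FACTS EXISTS** (any cube size `M`, any window radius `γ > 0`): the admissible reading of record on the run
towers of Part 1's termless generators, with Part 1's letters.  INHABITATION IS NOT CONTENT. [folklore] -/
theorem exists_readingData_EA_zero (F : T4Family) (M : ℕ) {γ : ℝ} (hγ : 0 < γ) :
    ∃ D : ReadingData F (MatA N) M,
      (∀ (γ' : ℝ) (k : ℕ) (g : ℕ → ℝ) U X, (D.u3Objects γ').EA k g U X = 0) ∧ (∀ (γ' : ℝ) (k : ℕ) (b : ℝ) (g : ℕ → ℝ) U X, (D.u3Objects γ').EB k b g U X = 0) ∧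
      (0 < D.li.C₀ ∧ 0 < D.li.θ₅ ∧ D.li.θ₅ < 1 ∧ 0 ≤ D.li.C₅ ∧ 2 * D.li.C₅ / (1 - D.li.θ₅) ≤ D.li.C₀ ∧ 0 < D.li.A ∧ D.li.θ₅ ≤ D.li.μ ∧
        D.li.C₀ ≤ 2 * D.li.A ∧ 0 < D.li.r ∧ 0 < D.li.s ∧ D.li.s < 1) ∧
      1 ≤ D.li.μ ∧ (D.li.analytic γ).Signs ∧ D.li.θ₅ ≤ (D.li.analytic γ).ω ∧ 0 < (D.li.analytic γ).ω := by
  have hex := fun k => exists_genTower_recTerm_eq_zero (F.P k) (MatA N) M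
  choose G _ hG using hex
  obtain ⟨li, hnum, hμ, hsg, hθω, hω0⟩ := exists_letterInputs_numerals_signs hγ
  exact ⟨ReadingData.ofRecordAdm F M N (runTowers fun k => toClusterTower (G k)) (fun _ _ _ => univ) (fun _ _ _ => 0) (fun _ _ _ => le_rfl) (fun _ _ => fun _ => 1)
      (fun _ _ _ _ _ => mem_univ _) li,
    fun γ' k g U X => u3Objects_ofRecordAdm_EA_eq_zero_of_recTerm G (fun _ _ _ => univ) (fun _ _ _ => 0) (fun _ _ _ => le_rfl) (fun _ _ => fun _ => 1)
      (fun _ _ _ _ _ => mem_univ _) li γ' hG k g U X,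
    fun γ' k b g U X => u3Objects_ofRecordAdm_EB_eq_zero_of_recTerm G (fun _ _ _ => univ) (fun _ _ _ => 0) (fun _ _ _ => le_rfl) (fun _ _ => fun _ => 1)
      (fun _ _ _ _ _ => mem_univ _) li γ' hG k b g U X,
    hnum, hμ, hsg, hθω, hω0⟩

/-- **A6 WITNESS, ANALYTIC SLOT (A)** — the binder list of `n22At_u3OfRecord₁₃_of_oscAnalytic θ u k` is inhabited at every tuple with `0 < θ.γ`. [folklore] -/
theorem oscAnalytic_binders_inhabited (hγ : 0 < θ.γ) :
    ∃ u : Node00.U3Objects₁₁, ∀ k : ℕ, ∃ C₀ M μ r s : ℝ,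
      PrefixDependenceOn (u.EA k) (Window θ.γ) ∧
      (∀ g ∈ Window θ.γ, ∀ g' ∈ Window θ.γ, ∀ (U : (u.levelCarriers k).BgA) (X : (u.levelCarriers k).Dom) (a : ℕ), a ≤ (u.levelCarriers k).scale X →
        (∀ n, a ≤ n → g n = g' n) → |u.EA k g U X - u.EA k g' U X| ≤ C₀ * u.θ₅ ^ ((u.levelCarriers k).scale X - a) * Real.exp (-(u.κ * (u.levelCarriers k).d X))) ∧
      (∀ g ∈ Window θ.γ, ∀ (U : (u.levelCarriers k).BgA) (X : (u.levelCarriers k).Dom) (i : ℕ), i < (u.levelCarriers k).scale X →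
        ∃ (Fz : ℂ → ℂ) (Dset : Set ℂ), DifferentiableOn ℂ Fz Dset ∧
          (∀ z ∈ Dset, ‖Fz z‖ ≤ M * μ ^ ((u.levelCarriers k).scale X - 1 - i) * Real.exp (-(u.κ * (u.levelCarriers k).d X))) ∧
          (∀ t ∈ Ioc (0 : ℝ) θ.γ, closedBall (t : ℂ) r ⊆ Dset) ∧ (∀ t ∈ Ioc (0 : ℝ) θ.γ, Fz t = (u.EA k (Function.update g i t) U X : ℂ))) ∧
      0 < C₀ ∧ 0 < u.θ₅ ∧ 0 < M ∧ u.θ₅ ≤ μ ∧ C₀ ≤ 2 * M ∧ 0 < r ∧ 0 < θ.γ ∧ 0 < s ∧ s < 1 ∧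
      u.ω = u.θ₅ ^ (1 - s) * μ ^ s ∧ u.C₉ = 32 / (s ^ 2 * min (r / 2) (θ.γ / 2)) * (C₀ ^ (1 - s) * (2 * M) ^ s) / (u.θ₅ ^ (1 - s) * μ ^ s) := by
  obtain ⟨D, hEA, -, hnum, -⟩ := exists_readingData_EA_zero (N := N) F θ.τ9.M hγ
  exact ⟨D.u3Objects θ.γ, fun k => oscAnalytic_binders_of_EA_zero θ D (hEA θ.γ) hnum hγ k⟩

/-- **A6 WITNESS, STRIP SLOT (A′)** — the binder list of `n22At_u3OfRecord₁₃_of_oscStrip θ u k` is inhabited at every tuple with `0 < θ.γ`. [folklore] -/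
theorem oscStrip_binders_inhabited (hγ : 0 < θ.γ) :
    ∃ u : Node00.U3Objects₁₁, ∀ k : ℕ, ∃ C₀ L μ r s : ℝ,
      PrefixDependenceOn (u.EA k) (Window θ.γ) ∧
      (∀ g ∈ Window θ.γ, ∀ g' ∈ Window θ.γ, ∀ (U : (u.levelCarriers k).BgA) (X : (u.levelCarriers k).Dom) (a : ℕ), a ≤ (u.levelCarriers k).scale X →
        (∀ n, a ≤ n → g n = g' n) → |u.EA k g U X - u.EA k g' U X| ≤ C₀ * u.θ₅ ^ ((u.levelCarriers k).scale X - a) * Real.exp (-(u.κ * (u.levelCarriers k).d X))) ∧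
      (∀ g ∈ Window θ.γ, ∀ (U : (u.levelCarriers k).BgA) (X : (u.levelCarriers k).Dom) (i : ℕ), i < (u.levelCarriers k).scale X →
        ∃ (Fz : ℂ → ℂ) (Dset : Set ℂ), DifferentiableOn ℂ Fz Dset ∧
          (∀ z ∈ Dset, ‖deriv Fz z‖ ≤ L * μ ^ ((u.levelCarriers k).scale X - 1 - i) * Real.exp (-(u.κ * (u.levelCarriers k).d X))) ∧
          (∀ t ∈ Ioc (0 : ℝ) θ.γ, ball (t : ℂ) r ⊆ Dset) ∧ (∀ t ∈ Ioc (0 : ℝ) θ.γ, Fz t = (u.EA k (Function.update g i t) U X : ℂ))) ∧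
      0 < C₀ ∧ 0 < u.θ₅ ∧ 0 < L ∧ u.θ₅ ≤ μ ∧ C₀ ≤ 2 * (L * r) ∧ 0 < r ∧ 0 < θ.γ ∧ 0 < s ∧ s < 1 ∧
      u.ω = u.θ₅ ^ (1 - s) * μ ^ s ∧ u.C₉ = 32 / (s ^ 2 * min (r / 2) (θ.γ / 2)) * (C₀ ^ (1 - s) * (2 * (L * r)) ^ s) / (u.θ₅ ^ (1 - s) * μ ^ s) := by
  obtain ⟨D, hEA, -, hnum, -⟩ := exists_readingData_EA_zero (N := N) F θ.τ9.M hγ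
  exact ⟨D.u3Objects θ.γ, fun k => oscStrip_binders_of_EA_zero θ D (hEA θ.γ) hnum hγ k⟩

/-- **A6 WITNESS, SECOND-DIFFERENCE SLOT (R₂)** — the binder list of `n22At_u3OfRecord₁₃_of_oscSecondDiff θ u k` is inhabited at every tuple with `0 < θ.γ`. [folklore] -/
theorem oscSecondDiff_binders_inhabited (hγ : 0 < θ.γ) :
    ∃ u : Node00.U3Objects₁₁, ∀ k : ℕ, ∃ C₀ M μ ρ : ℝ,
      PrefixDependenceOn (u.EA k) (Window θ.γ) ∧
      (∀ g ∈ Window θ.γ, ∀ g' ∈ Window θ.γ, ∀ (U : (u.levelCarriers k).BgA) (X : (u.levelCarriers k).Dom) (a : ℕ), a ≤ (u.levelCarriers k).scale X →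
        (∀ n, a ≤ n → g n = g' n) → |u.EA k g U X - u.EA k g' U X| ≤ C₀ * u.θ₅ ^ ((u.levelCarriers k).scale X - a) * Real.exp (-(u.κ * (u.levelCarriers k).d X))) ∧
      (∀ g ∈ Window θ.γ, ∀ (U : (u.levelCarriers k).BgA) (X : (u.levelCarriers k).Dom) (i : ℕ), i < (u.levelCarriers k).scale X → ∀ t d : ℝ, 0 < d →
        t - d ∈ Ioc (0 : ℝ) θ.γ → t + d ∈ Ioc (0 : ℝ) θ.γ →
          |u.EA k (Function.update g i (t + d)) U X - 2 * u.EA k (Function.update g i t) U X + u.EA k (Function.update g i (t - d)) U X| ≤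
            M * μ ^ ((u.levelCarriers k).scale X - 1 - i) * Real.exp (-(u.κ * (u.levelCarriers k).d X)) * d ^ 2) ∧
      0 ≤ C₀ ∧ 0 ≤ u.θ₅ ∧ 0 ≤ M ∧ 0 ≤ μ ∧ 0 < θ.γ ∧ 0 < ρ ∧ ρ ≤ 1 ∧ u.θ₅ ≤ u.ω * ρ ∧ μ * ρ ≤ u.ω ∧ 0 < u.ω ∧
      u.C₉ = (4 * C₀ / θ.γ + M * θ.γ / 2) / u.ω := by
  obtain ⟨D, hEA, -, -, -, hsg, hθω, hω0⟩ := exists_readingData_EA_zero (N := N) F θ.τ9.M hγ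
  exact ⟨D.u3Objects θ.γ, fun k => oscSecondDiff_binders_of_EA_zero θ D (hEA θ.γ) hsg hθω hω0 hγ k⟩

/-- **A6 WITNESS, «`FadingMemory` BY NAME FROM A MODULUS»** — the binder list of `n22At_u3OfRecord₁₃_of_ne9_fading θ u k` (signs, NE9 in a fading table, `C₉ ≤ u.C₉`, `ω = u.ω`)
is inhabited at every tuple with `0 < θ.γ`. [folklore] -/
theorem ne9_fading_binders_inhabited (hγ : 0 < θ.γ) :
    ∃ u : Node00.U3Objects₁₁, u.Signs ∧ ∀ k : ℕ, ∃ (Λ : ℕ → ℕ → ℝ) (C₉ ω : ℝ),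
      NE9 (u.EA k) (Window θ.γ) u.κ Λ ∧ FadingMemory C₉ ω Λ ∧ C₉ ≤ u.C₉ ∧ ω = u.ω := by
  obtain ⟨D, hEA, -, -, -, hsg, -⟩ := exists_readingData_EA_zero (N := N) F θ.τ9.M hγ
  exact ⟨D.u3Objects θ.γ, ne9_fading_binders_of_EA_zero θ D (hEA θ.γ) hsg⟩

end Slots

/-! ## §3 The CoPH stub-level knits' OWN binder lists — `S_N18` at the v1.7 rate record INCLUDED — are jointly inhabited (№189 (3) literal shape) -/

section StubLevel

variable (ne1 : (F : T4Family) → Stage13HParams F N → (ℕ → ℝ) → List (ULoop F) → NE1pCarriers)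

/-- **A6 WITNESS FOR 8c″ᶜᵒᵖᴴ `s_N22_readingOfRecord₁₃CoPH_gen_of_s_N18_schemasBelow`** (module `…N22AtGeneratedHistory13CoPH`, canonical home at the reading of record with the
admissible W1 component on generated run towers): for EVERY dressed-tower coordinate `ne1` (N14's passive slot, never read by the knit) there are generator families,
tables, gauges, transports, letters, NE3 letters and NE2 objects such that the knit's THREE hypotheses hold together — `S_N18` AT THE v1.7 RATE RECORD `RRec₁₃CoPH` of that reading
(at EVERY Stage-13 datum key of record, by `N18At` at vanishing functionals — NOT by emptiness of the key class), the sharp schema package at every admissible tuple and run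
length, the eleven numerals.  Its `…CoPHOn` ∕ `rRec₁₃CoPH_w1_gen` ∕ `ofRecordGen` ∕ tuple-reading siblings carry the same binders pointwise.  INHABITATION IS NOT CONTENT. [folklore] -/
theorem s_N22_readingOfRecord₁₃CoPH_gen_of_s_N18_schemasBelow_binders_inhabited :
    ∃ (G : (F : T4Family) → (θ : Stage13HParams F N) → (k : ℕ) → GenTower (F.P k) (MatA N) θ.τ9.M)
      (sp : (F : T4Family) → (θ : Stage13HParams F N) → (k j : ℕ) → (domSys (F.P k) θ.τ9.M j).Dom → Set (CPair (F.P k) (MatA N)))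
      (gauge : (F : T4Family) → (θ : Stage13HParams F N) → (k : ℕ) → GaugeField (F.P k) 0 (Node00.SU N) → GaugeField (F.P k) 0 (Node00.SU N) → ℝ)
      (hg : ∀ (F : T4Family) (θ : Stage13HParams F N) (k : ℕ) (U U' : GaugeField (F.P k) 0 (Node00.SU N)), 0 ≤ gauge F θ k U U')
      (T₀ : (F : T4Family) → (θ : Stage13HParams F N) → (k : ℕ) → GaugeField (F.P (k + 1)) 0 (Node00.SU N) → GaugeField (F.P k) 0 (Node00.SU N))
      (hT₀ : ∀ (F : T4Family) (θ : Stage13HParams F N) (k : ℕ) (U : GaugeField (F.P (k + 1)) 0 (Node00.SU N)),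
        (∀ (j : ℕ) (Y : (domSys (F.P (k + 1)) θ.τ9.M j).Dom), ofBackgroundC (ιSU N) U ∈ sp F θ (k + 1) j Y) →
        ∀ (j : ℕ) (Y : (domSys (F.P k) θ.τ9.M j).Dom), ofBackgroundC (ιSU N) (T₀ F θ k U) ∈ sp F θ k j Y)
      (li : (F : T4Family) → Stage13HParams F N → LetterInputs) (ℓ₃ : T4Family → NE3Letters₁₁)
      (ne2 : (F : T4Family) → Stage13HParams F N → (ℕ → ℝ) → List (ULoop F) → ℕ → NE2Objects₁₁),
      S_N18 (RRec₁₃CoPH (readingOfRecord₁₃CoPH (fun F θ => ReadingData.ofRecordAdm F θ.τ9.M N (runTowers fun k => toClusterTower (G F θ k)) (sp F θ) (gauge F θ) (hg F θ)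
        (T₀ F θ) (hT₀ F θ) (li F θ)) ℓ₃ ne2 ne1)) ∧
      (∀ (F : T4Family) (θ : Stage13HParams F N), θ.Provisos₁₃CoPH F N → θ.Admissible F N → ∀ (k : ℕ),
        ∃ (Dk : Set ℂ) (Adm : (m : ℕ) → Set (OlderTerms (F.P k) (MatA N) θ.τ9.M m)),
          IsOpen Dk ∧ (∀ z ∈ Dk, conj z ∈ Dk) ∧ (∀ t ∈ Ioc (0 : ℝ) θ.γ, closedBall (t : ℂ) (li F θ).r ⊆ Dk) ∧
          (∀ g : ℕ → ℂ, (∀ n, g n ∈ Dk) → ∀ m < k, olderOf (recTerm (G F θ k) g) m ∈ Adm m) ∧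
          (∀ m < k, (G F θ k m).AnalyticInLast Dk (Adm m) (sp F θ k (m + 1))) ∧
          (∀ m < k, (G F θ k m).PropagatesAnalyticity Dk (Adm m) (fun j : Fin (m + 1) => sp F θ k j) (sp F θ k (m + 1))) ∧
          (∀ g ∈ Window θ.γ, ∀ (i j : ℕ), i < j → j ≤ k → ∀ (X : (domSys (F.P k) θ.τ9.M j).Dom), ∀ φ ∈ sp F θ k j X, ∀ z ∈ Dk,
            ‖recTerm (G F θ k) (Function.update (fun n => ((g n : ℝ) : ℂ)) i z) j X φ‖ ≤
              (li F θ).A * (li F θ).μ ^ (j - 1 - i) * Real.exp (-((li F θ).κ * (domSys (F.P k) θ.τ9.M j).dj X)))) ∧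
      (∀ (F : T4Family) (θ : Stage13HParams F N), θ.Provisos₁₃CoPH F N → θ.Admissible F N →
        0 < (li F θ).C₀ ∧ 0 < (li F θ).θ₅ ∧ (li F θ).θ₅ < 1 ∧ 0 ≤ (li F θ).C₅ ∧ 2 * (li F θ).C₅ / (1 - (li F θ).θ₅) ≤ (li F θ).C₀ ∧ 0 < (li F θ).A ∧
          (li F θ).θ₅ ≤ (li F θ).μ ∧ (li F θ).C₀ ≤ 2 * (li F θ).A ∧ 0 < (li F θ).r ∧ 0 < (li F θ).s ∧ (li F θ).s < 1) := by
  have hex := fun (F : T4Family) (θ : Stage13HParams F N) (k : ℕ) => exists_genTower_recTerm_eq_zero (F.P k) (MatA N) θ.τ9.M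
  choose G hE hG using hex
  obtain ⟨li, hnum, -⟩ := exists_letterInputs_numerals_signs one_pos
  obtain ⟨o⟩ := Node00.nonempty_rateObjects₁₁ N
  refine ⟨G, fun _ _ _ _ _ => univ, fun _ _ _ _ _ => 0, fun _ _ _ _ _ => le_rfl, fun _ _ _ _ => fun _ => 1, fun _ _ _ _ _ _ _ => mem_univ _, fun _ _ => li,
    fun _ => ⟨0, 0, 0, 0, 0, 0⟩, fun _ _ _ _ => o.ne2, ?_, fun F θ _ _ k => ?_, fun F θ _ _ => hnum⟩
  · rw [s_N18_readingOfRecord₁₃CoPH_iff]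
    intro F D h k
    exact n18At_u3OfRecord₁₃_of_EA_EB_zero _ _ k hnum.2.2.2.1 hnum.2.1.le
      (fun g U X => u3Objects_ofRecordAdm_EA_eq_zero_of_recTerm (G F h.params) (fun _ _ _ => univ) (fun _ _ _ => 0) (fun _ _ _ => le_rfl) (fun _ _ => fun _ => 1)
        (fun _ _ _ _ _ => mem_univ _) li h.params.γ (hG F h.params) k g U X)
      (fun b g U X => u3Objects_ofRecordAdm_EB_eq_zero_of_recTerm (G F h.params) (fun _ _ _ => univ) (fun _ _ _ => 0) (fun _ _ _ => le_rfl) (fun _ _ => fun _ => 1)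
        (fun _ _ _ _ _ => mem_univ _) li h.params.γ (hG F h.params) k b g U X)
  · refine ⟨univ, fun _ => univ, isOpen_univ, fun z _ => mem_univ _, fun t _ => subset_univ _, fun g _ m _ => mem_univ _,
      fun m _ old _ X φ _ => ?_, fun m _ c _ _ t _ X φ _ => ?_, fun g _ i j _ _ X φ _ z _ => ?_⟩
    · have : (fun t : ℂ => (G F θ k m).E t old φ X) = fun _ => 0 := funext fun t => hE F θ k m t old φ X
      rw [this]
      exact analyticOnNhd_const
    · have : (fun s : ℂ => (G F θ k m).E t (c s) φ X) = fun _ => 0 := funext fun s => hE F θ k m t (c s) φ X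
      rw [this]
      exact analyticOnNhd_const
    · rw [hG, norm_zero]
      exact mul_nonneg (mul_nonneg hnum.2.2.2.2.2.1.le (pow_nonneg (hnum.2.1.le.trans hnum.2.2.2.2.2.2.1) _)) (Real.exp_nonneg _)

/-- **A6 WITNESS FOR 8a″ᶜᵒᵖᴴ `s_N22_readingOfRecord₁₃CoPH_ofRecordAdm_of_s_N18_analytic`** (module `…N22EdgeAtW1AdmReadingOfRecord13CoPH`, canonical home, analytic sup-letter
currency; 7″ᶜᵒᵖᴴ's `s_N22_readingOfRecord₁₃CoPH_of_s_N18_analytic` is the same knit with dag-n22-c's coherence binder, inhabited BY NAME by `pairingCoherence_ofRecordAdm`): for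
every `ne1` there are towers, tables, gauges, transports, letters, NE3 letters, NE2 objects with `S_N18` AT THE RATE RECORD of the reading, the pin (J), the analytic letter (A)
per admissible tuple, run length and admissible background, and the eleven numerals — together.  INHABITATION IS NOT CONTENT. [folklore] -/
theorem s_N22_readingOfRecord₁₃CoPH_ofRecordAdm_of_s_N18_analytic_binders_inhabited :
    ∃ (S : (F : T4Family) → (θ : Stage13HParams F N) → (k : ℕ) → ClusterTower (F.P k) (MatA N) θ.τ9.M)
      (sp : (F : T4Family) → (θ : Stage13HParams F N) → (k j : ℕ) → (domSys (F.P k) θ.τ9.M j).Dom → Set (CPair (F.P k) (MatA N)))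
      (gauge : (F : T4Family) → (θ : Stage13HParams F N) → (k : ℕ) → GaugeField (F.P k) 0 (Node00.SU N) → GaugeField (F.P k) 0 (Node00.SU N) → ℝ)
      (hg : ∀ (F : T4Family) (θ : Stage13HParams F N) (k : ℕ) (U U' : GaugeField (F.P k) 0 (Node00.SU N)), 0 ≤ gauge F θ k U U')
      (T₀ : (F : T4Family) → (θ : Stage13HParams F N) → (k : ℕ) → GaugeField (F.P (k + 1)) 0 (Node00.SU N) → GaugeField (F.P k) 0 (Node00.SU N))
      (hT₀ : ∀ (F : T4Family) (θ : Stage13HParams F N) (k : ℕ) (U : GaugeField (F.P (k + 1)) 0 (Node00.SU N)),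
        (∀ (j : ℕ) (Y : (domSys (F.P (k + 1)) θ.τ9.M j).Dom), ofBackgroundC (ιSU N) U ∈ sp F θ (k + 1) j Y) →
        ∀ (j : ℕ) (Y : (domSys (F.P k) θ.τ9.M j).Dom), ofBackgroundC (ιSU N) (T₀ F θ k U) ∈ sp F θ k j Y)
      (li : (F : T4Family) → Stage13HParams F N → LetterInputs) (ℓ₃ : T4Family → NE3Letters₁₁)
      (ne2 : (F : T4Family) → Stage13HParams F N → (ℕ → ℝ) → List (ULoop F) → ℕ → NE2Objects₁₁),
      S_N18 (RRec₁₃CoPH (readingOfRecord₁₃CoPH (fun F θ => ReadingData.ofRecordAdm F θ.τ9.M N (S F θ) (sp F θ) (gauge F θ) (hg F θ) (T₀ F θ) (hT₀ F θ) (li F θ))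
        ℓ₃ ne2 ne1)) ∧
      (∀ (F : T4Family) (θ : Stage13HParams F N), θ.Provisos₁₃CoPH F N → θ.Admissible F N →
        ∀ (k : ℕ) (X : Node00.W1.Dom (F.P k) θ.τ9.M), k < X.1 → ∀ (g : ℕ → ℝ) (φ : CPair (F.P k) (MatA N)), functionalC (S F θ k) g φ X = 0) ∧
      (∀ (F : T4Family) (θ : Stage13HParams F N), θ.Provisos₁₃CoPH F N → θ.Admissible F N → ∀ (k : ℕ),
        ∀ g ∈ Window θ.γ, ∀ (U : AdmBg F θ.τ9.M N (sp F θ) k) (X : Node00.W1.Dom (F.P k) θ.τ9.M) (i : ℕ), i < X.1 →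
          ∃ (Fz : ℂ → ℂ) (Dset : Set ℂ), DifferentiableOn ℂ Fz Dset ∧
            (∀ z ∈ Dset, ‖Fz z‖ ≤ (li F θ).A * (li F θ).μ ^ (X.1 - 1 - i) * Real.exp (-((li F θ).κ * (domSys (F.P k) θ.τ9.M X.1).dj X.2))) ∧
            (∀ t ∈ Ioc (0 : ℝ) θ.γ, closedBall (t : ℂ) (li F θ).r ⊆ Dset) ∧
            (∀ t ∈ Ioc (0 : ℝ) θ.γ, Fz t = ((functionalC (S F θ k) (Function.update g i t) (ofBackgroundC (ιSU N) U.1) X).re : ℂ))) ∧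
      (∀ (F : T4Family) (θ : Stage13HParams F N), θ.Provisos₁₃CoPH F N → θ.Admissible F N →
        0 < (li F θ).C₀ ∧ 0 < (li F θ).θ₅ ∧ (li F θ).θ₅ < 1 ∧ 0 ≤ (li F θ).C₅ ∧ 2 * (li F θ).C₅ / (1 - (li F θ).θ₅) ≤ (li F θ).C₀ ∧ 0 < (li F θ).A ∧
          (li F θ).θ₅ ≤ (li F θ).μ ∧ (li F θ).C₀ ≤ 2 * (li F θ).A ∧ 0 < (li F θ).r ∧ 0 < (li F θ).s ∧ (li F θ).s < 1) := by
  have hex := fun (F : T4Family) (θ : Stage13HParams F N) (k : ℕ) => exists_genTower_recTerm_eq_zero (F.P k) (MatA N) θ.τ9.M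
  choose G _ hG using hex
  obtain ⟨li, hnum, -⟩ := exists_letterInputs_numerals_signs one_pos
  obtain ⟨o⟩ := Node00.nonempty_rateObjects₁₁ N
  refine ⟨fun F θ => runTowers fun k => toClusterTower (G F θ k), fun _ _ _ _ _ => univ, fun _ _ _ _ _ => 0, fun _ _ _ _ _ => le_rfl, fun _ _ _ _ => fun _ => 1,
    fun _ _ _ _ _ _ _ => mem_univ _, fun _ _ => li, fun _ => ⟨0, 0, 0, 0, 0, 0⟩, fun _ _ _ _ => o.ne2, ?_,
    fun F θ _ _ k X _ g φ => functionalC_runTowers_toClusterTower_eq_zero (G F θ) (hG F θ) k g φ X, fun F θ _ _ k g _ U X i _ => ?_, fun F θ _ _ => hnum⟩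
  · rw [s_N18_readingOfRecord₁₃CoPH_iff]
    intro F D h k
    exact n18At_u3OfRecord₁₃_of_EA_EB_zero _ _ k hnum.2.2.2.1 hnum.2.1.le
      (fun g U X => u3Objects_ofRecordAdm_EA_eq_zero_of_recTerm (G F h.params) (fun _ _ _ => univ) (fun _ _ _ => 0) (fun _ _ _ => le_rfl) (fun _ _ => fun _ => 1)
        (fun _ _ _ _ _ => mem_univ _) li h.params.γ (hG F h.params) k g U X)
      (fun b g U X => u3Objects_ofRecordAdm_EB_eq_zero_of_recTerm (G F h.params) (fun _ _ _ => univ) (fun _ _ _ => 0) (fun _ _ _ => le_rfl) (fun _ _ => fun _ => 1)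
        (fun _ _ _ _ _ => mem_univ _) li h.params.γ (hG F h.params) k b g U X)
  · refine ⟨fun _ => 0, univ, differentiableOn_const 0, fun z _ => ?_, fun t _ => subset_univ _, fun t _ => ?_⟩
    · rw [norm_zero]
      exact mul_nonneg (mul_nonneg hnum.2.2.2.2.2.1.le (pow_nonneg (hnum.2.1.le.trans hnum.2.2.2.2.2.2.1) _)) (Real.exp_nonneg _)
    · rw [functionalC_runTowers_toClusterTower_eq_zero (G F θ) (hG F θ)]
      simp

end StubLevel

end YMDAG.N22

end
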